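import Mathlib
import Literature.NumberTheory.LFunctions.BernoulliOneOdd
import Summits.HodgeConjecture.FermatCycles.HodgeFermatBadVanishB

/-!
# The Bad coefficients vanish — part 3: where the BAD characters lie; the exceptional sets `badMu`, `badNu` (`HodgeFermat/BadVanish.lean`; HF-G33)

Tree copy (part 3 of 4) of the module `HodgeFermat/BadVanish.lean` of the sibling cell's standalone package
`run/shared/lean/pub/pub-hodgefermat/lean/HodgeFermat/` (996 lines, sha256 `0bc1ccd5eb68b6bb…`), source lines 468–700 (§5 where the BAD characters lie: `mem_oddK_of_bad`, `mem_cosetC_of_bad`; §6 the exceptional sets `badMu`, `badNu` and their cardinalities).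
Filed by cell `pub-hfermat`, seat prover-1 gen-2, on the COORDINATOR KEEPER RULING of 2026-08-25 (gem sweep H1: take the
off-gate kernel theorem `thmFstar` through the gate) — here its second namesake, `HodgeFermat/ThmFstarNFinal.lean:29`,
THEOREM F*(3N) at every admissible squarefree level (the first, `DecodingFinal.thmFstar` = THEOREM F* at the prime levels,
landed on 2026-08-25 as `HodgeFermatThmFstar.lean`, seat prover-1 gen-0); this file is one link of the import closure of
`ThmFstarNFinal.thmFstar` on top of that landed chain.  The source module's declarations are VERBATIM those of the cell record
`check/ThmFstarN_standalone.lean` (21 bodies, 438 871 B, sha256 ced731ec52c92191…, hub `lean check` rc 0, 222.2 s, `--axioms …ThmFstarN.thmFstarN` = [propext, Classical.choice, Quot.sound]; pub-hodgefermat `CERT.md` l.987, GATE HF-G33).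
Deviations from the source module, exhaustively: the `import` lines (tree modules `Summits.HodgeConjecture.FermatCycles.
HodgeFermat*` instead of `HodgeFermat.*`); this module docstring; the `set_option`/namespace/`open` preamble (source l.37–48) is repeated at the top because the module is split, followed by the two `open … renaming …` lines of part 1 (`odd_inv'` is used at source l.661); DEDUP (pre-empting the gate's `dedup.landed`): the source's `lemma chi3_congr` (l.512) restates the landed `HodgeFermat.KRFree.Decoding.chi3_congr` (`HodgeFermatDecodingB.lean`) VERBATIM up to the names of the bound variables and is therefore DELETED, its uses resolving to the landed lemma through the added line `open HodgeFermat.KRFree.Decoding (chi3_congr)`; one-line docstrings added (gate lint) to `chi3_of_mod_one`, `chi3_of_mod_two`, `two_mul_card_badMu_le`, `card_badNu_le`. The module docstring is quoted in full in part 1.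
Every other line — in particular every declaration's statement and proof — is byte-identical to the source.
HONEST FRAMING: explicit algebraic cycles for specific Hodge classes on Fermat/Delsarte varieties; residual open instances
listed; no claim on general Hodge.  (This file is arithmetic of CM types / of `(ℤ/N)ˣ`; it claims nothing about cycles.)
-/

set_option autoImplicit false

namespace HodgeFermat.KRFree.BadVanish

open Finset HodgeFermat.KRFree.LemmaN HodgeFermat.KRFree.TwistedMoment HodgeFermat.KRFree.LemmaEMu
open HodgeFermat.KRFree.LemmaEGood
open HodgeFermat.KRFree.ChiThree (chi3 chi3_mul_self)
open HodgeFermat.KRFree.NuChar (chi3Mul chi3Mul_natCast)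
open HodgeFermat.KRFree.MuEven (muEntry muFun)
open HodgeFermat.KRFree.NuOdd (nuEntry nuFun nuEntry_eq_zero)
open HodgeFermat.KRFree.HypVDefs (tauV IneqV)
open DirichletCharacter (changeLevel annihilator subgroupOfPrimitiveMapToOne)
open Literature.NumberTheory.LFunctions.BernoulliOneOdd renaming odd_inv → odd_inv'
open HodgeFermat.KRFree.NuOdd renaming even_inv → even_inv'
open HodgeFermat.KRFree.Decoding (chi3_congr)
/-! ## 5. Where the BAD characters lie -/

section bad

variable {N : ℕ} [NeZero N]

/-- an odd BAD character lies in some `oddK N q`, `q ∣ N` prime (Mathlib's `mem_subgroupOfPrimitiveMapToOne_iff`) -/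
theorem mem_oddK_of_bad {ψ : DirichletCharacter ℂ N} (hψ : ψ.Odd) (hbad : ¬ Good ψ) :
    ∃ q ∈ N.primeFactors, ψ ∈ oddK N q := by
  classical
  unfold Good at hbad
  push Not at hbad
  obtain ⟨q, hq, h1⟩ := hbad
  have hqq : q.Prime := Nat.prime_of_mem_primeFactors hq
  haveI := Fact.mk hqq
  refine ⟨q, hq, ?_⟩
  rw [oddK, dif_pos hqq, Finset.mem_filter]
  exact ⟨Finset.mem_univ _, (DirichletCharacter.mem_subgroupOfPrimitiveMapToOne_iff ψ q).mpr h1, hψ⟩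

/-- a primitive character with the value `1` at `q` has conductor prime to `q` -/
lemma not_dvd_conductor_of_eq_one {L : ℕ} (χ : DirichletCharacter ℂ L) {q : ℕ} (hq : q.Prime)
    (h1 : χ.primitiveCharacter (q : ZMod χ.conductor) = 1) : ¬ q ∣ χ.conductor := by
  intro hdvd
  have hnu : ¬ IsUnit ((q : ℕ) : ZMod χ.conductor) := by
    intro hu
    have hcop := (ZMod.isUnit_iff_coprime q χ.conductor).mp hu
    exact hq.one_lt.ne' (Nat.Coprime.eq_one_of_dvd hcop hdvd)
  exact one_ne_zero (h1.symm.trans (MulChar.map_nonunit _ hnu))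

/-- a unit `≡ 1` modulo the conductor has the character value `1` -/
lemma apply_eq_one_of_modEq_one {L : ℕ} [NeZero L] (χ : DirichletCharacter ℂ L) {x : ℕ}
    (hx : Nat.Coprime x L) (h : x ≡ 1 [MOD χ.conductor]) : χ (x : ZMod L) = 1 := by
  have key := primitiveCharacter_apply_of_modEq χ (q := 1) hx h
  rw [Nat.cast_one, map_one] at key
  exact key.symm

/-- value of a lift `q′ ≡ q (mod f)` prime to the level: `χ(q′) = χ₀(q)` -/
lemma apply_eq_of_modEq {L : ℕ} [NeZero L] (χ : DirichletCharacter ℂ L) {q x : ℕ}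
    (hx : Nat.Coprime x L) (h : x ≡ q [MOD χ.conductor])
    (h1 : χ.primitiveCharacter (q : ZMod χ.conductor) = 1) : χ (x : ZMod L) = 1 := by
  rw [← primitiveCharacter_apply_of_modEq χ hx h, h1]

/-- `χ₃(x) = 1` for `x ≡ 1 (mod 3)` -/
lemma chi3_of_mod_one {x : ℕ} (h : x % 3 = 1) : chi3 x = 1 := by unfold chi3; simp [h]
/-- `χ₃(x) = −1` for `x ≡ 2 (mod 3)` -/
lemma chi3_of_mod_two {x : ℕ} (h : x % 3 = 2) : chi3 x = -1 := by unfold chi3; simp [h]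
-- `chi3_congr` (source l.512): DELETED — verbatim restatement of the landed `HodgeFermat.KRFree.Decoding.chi3_congr`,
-- opened at the top of this file.

/-- **Structure of the BAD even characters.**  For squarefree `N` with `3 ∤ N` and `ψ` mod `N` with `χ₃ × ψ` BAD
(its primitive character is `1` at a prime `q ∣ 3N`): `q ≠ 3` (ramification), `q ∣ N`, and `ψ` is induced from a
character mod `N/q` taking the value `χ₃(q)` at `q` — `ψ ∈ cosetC N q`. -/
theorem mem_cosetC_of_bad (hsq : Squarefree N) (h3N : ¬ 3 ∣ N) (ψ : DirichletCharacter ℂ N)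
    (hbad : ¬ Good (chi3Mul ψ)) : ∃ q ∈ N.primeFactors, ψ ∈ cosetC N q := by
  classical
  haveI : NeZero (3 * N) := ⟨by have := NeZero.ne N; omega⟩
  have hN0 : N ≠ 0 := NeZero.ne N
  set χ := chi3Mul ψ with hχdef
  set f := χ.conductor with hfdef
  have hf3N : f ∣ 3 * N := χ.conductor_dvd_level
  have co3N : Nat.Coprime 3 N := (Nat.Prime.coprime_iff_not_dvd Nat.prime_three).mpr h3N
  unfold Good at hbad
  push Not at hbad
  obtain ⟨q, hq3N, h1⟩ := hbad
  have hqq : q.Prime := Nat.prime_of_mem_primeFactors hq3N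
  have hqf : ¬ q ∣ f := not_dvd_conductor_of_eq_one χ hqq h1
  -- (A) `q ≠ 3`: otherwise `f ∣ N` and the two lifts `≡ 3 (mod N)`, `≡ 1, 2 (mod 3)` give `ψ(3) = 1 = -ψ(3)`
  have hq3 : q ≠ 3 := by
    intro hq3e
    rw [hq3e] at hqf h1
    have hfN : f ∣ N := (Nat.Coprime.symm ((Nat.Prime.coprime_iff_not_dvd Nat.prime_three).mpr hqf)).dvd_of_dvd_mul_left hf3N
    obtain ⟨q₁, hq₁3, hq₁N⟩ := Nat.chineseRemainder co3N 1 3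
    obtain ⟨q₂, hq₂3, hq₂N⟩ := Nat.chineseRemainder co3N 2 3
    have cop : ∀ {x : ℕ}, x % 3 ≠ 0 → x ≡ 3 [MOD N] → Nat.Coprime x (3 * N) := by
      intro x hx3 hxN
      refine coprime_three_mul_iff.mpr ⟨fun h => hx3 (by omega), ?_⟩
      rw [Nat.Coprime, hxN.gcd_eq]; exact co3N
    have hc₁ : Nat.Coprime q₁ (3 * N) := cop (by unfold Nat.ModEq at hq₁3; omega) hq₁N
    have hc₂ : Nat.Coprime q₂ (3 * N) := cop (by unfold Nat.ModEq at hq₂3; omega) hq₂N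
    have e₁ := apply_eq_of_modEq χ hc₁ (hq₁N.of_dvd hfN) h1
    have e₂ := apply_eq_of_modEq χ hc₂ (hq₂N.of_dvd hfN) h1
    rw [hχdef, chi3Mul_natCast ψ hc₁, chi3_of_mod_one (by unfold Nat.ModEq at hq₁3; omega)] at e₁
    rw [hχdef, chi3Mul_natCast ψ hc₂, chi3_of_mod_two (by unfold Nat.ModEq at hq₂3; omega)] at e₂
    have e3 : ((q₁ : ℕ) : ZMod N) = ((q₂ : ℕ) : ZMod N) := by
      rw [(ZMod.natCast_eq_natCast_iff' q₁ 3 N).mpr hq₁N, (ZMod.natCast_eq_natCast_iff' q₂ 3 N).mpr hq₂N]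
    rw [e3] at e₁
    push_cast at e₁ e₂
    have : (0 : ℂ) = 2 := by linear_combination e₁ + e₂
    norm_num at this
  -- (B) so `q ∣ N`; put `M = N / q`
  have hqN : q ∣ N := by
    rcases (Nat.Prime.dvd_mul hqq).mp (Nat.dvd_of_mem_primeFactors hq3N) with h | h
    · exact absurd ((Nat.prime_dvd_prime_iff_eq hqq Nat.prime_three).mp h) hq3
    · exact h
  have hq : q ∈ N.primeFactors := Nat.mem_primeFactors.mpr ⟨hqq, hqN, hN0⟩
  obtain ⟨-, -, -, hcopqM, hMpos⟩ := sqf_facts hsq hq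
  set M := N / q with hMdef
  haveI : NeZero M := ⟨hMpos.ne'⟩
  have hMN : M ∣ N := Nat.div_dvd_of_dvd hqN
  have hNMq : N = M * q := (Nat.div_mul_cancel hqN).symm
  have co3q : Nat.Coprime 3 q := (Nat.coprime_primes Nat.prime_three hqq).mpr (Ne.symm hq3)
  have co3M : Nat.Coprime 3 M := Nat.Coprime.coprime_dvd_right hMN co3N
  -- `f ∣ 3M`
  have hf3M : f ∣ 3 * M := by
    have hcf : Nat.Coprime f q := Nat.Coprime.symm ((Nat.Prime.coprime_iff_not_dvd hqq).mpr hqf)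
    have : f ∣ 3 * M * q := by rw [mul_assoc, ← hNMq]; exact hf3N
    exact hcf.dvd_of_dvd_mul_right this
  -- `ψ` factors through `M`: a unit `u ≡ 1 (mod M)` lifts to `j ≡ 1 (mod 3M)`, so `χ(j) = 1 = ψ(u)`
  have hFT : ψ.FactorsThrough M := by
    rw [DirichletCharacter.factorsThrough_iff_ker_unitsMap hMN]
    intro u hu
    rw [MonoidHom.mem_ker] at hu
    rw [MonoidHom.mem_ker, ← Units.val_eq_one, MulChar.coe_toUnitHom]
    have hu1 : (((u : ZMod N).val : ℕ) : ZMod M) = 1 := by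
      have h := congrArg (fun v : (ZMod M)ˣ => (v : ZMod M)) hu
      simp only [ZMod.unitsMap_def, Units.coe_map, MonoidHom.coe_coe, ZMod.castHom_apply, Units.val_one] at h
      rw [ZMod.cast_eq_val] at h
      exact h
    have hu1' : (u : ZMod N).val ≡ 1 [MOD M] := by
      have := (ZMod.natCast_eq_natCast_iff' (u : ZMod N).val 1 M).mp (by rw [hu1, Nat.cast_one])
      exact this
    obtain ⟨j, hj3, hjN⟩ := Nat.chineseRemainder co3N 1 (u : ZMod N).val
    have hjM : j ≡ 1 [MOD M] := (hjN.of_dvd hMN).trans hu1'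
    have hj3M : j ≡ 1 [MOD 3 * M] := (Nat.modEq_and_modEq_iff_modEq_mul co3M).mp ⟨hj3, hjM⟩
    have hjcopN : Nat.Coprime j N := by
      rw [Nat.Coprime, hjN.gcd_eq]; exact ZMod.val_coe_unit_coprime u
    have hjcop : Nat.Coprime j (3 * N) :=
      coprime_three_mul_iff.mpr ⟨by unfold Nat.ModEq at hj3; omega, hjcopN⟩
    have e := apply_eq_one_of_modEq_one χ hjcop (hj3M.of_dvd hf3M)
    rw [hχdef, chi3Mul_natCast ψ hjcop, chi3_of_mod_one (by unfold Nat.ModEq at hj3; omega)] at e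
    have ej : ((j : ℕ) : ZMod N) = (u : ZMod N) := by
      rw [(ZMod.natCast_eq_natCast_iff' j (u : ZMod N).val N).mpr hjN, ZMod.natCast_zmod_val]
    rw [ej] at e
    push_cast at e
    rw [one_mul] at e
    exact e
  set θ := hFT.χ₀ with hθdef
  have hψθ : ψ = changeLevel hMN θ := hFT.eq_changeLevel
  -- the value at `q`: the lift `q₁ ≡ q (mod 3M)`, `q₁ ≡ 1 (mod q)` has `χ(q₁) = χ₀(q) = 1 = χ₃(q) θ(q)`
  have co3Mq : Nat.Coprime (3 * M) q := Nat.Coprime.mul_left co3q (Nat.Coprime.symm hcopqM)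
  obtain ⟨q₁, hq₁, hq₁'⟩ := Nat.chineseRemainder co3Mq q 1
  have hq₁cop : Nat.Coprime q₁ (3 * N) := by
    have h1' : Nat.Coprime q₁ (3 * M) := by
      rw [Nat.Coprime, hq₁.gcd_eq]
      exact Nat.Coprime.mul_right co3q.symm hcopqM
    have h2' : Nat.Coprime q₁ q := by
      rw [Nat.Coprime, hq₁'.gcd_eq]; exact Nat.coprime_one_left q
    have := Nat.Coprime.mul_right h1' h2'
    rwa [mul_assoc, ← hNMq] at this
  have e := apply_eq_of_modEq χ hq₁cop (hq₁.of_dvd hf3M) h1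
  have hq₁3 : q₁ % 3 = q % 3 := hq₁.of_dvd (dvd_mul_right 3 M)
  have hq₁M : ((q₁ : ℕ) : ZMod M) = ((q : ℕ) : ZMod M) :=
    (ZMod.natCast_eq_natCast_iff' q₁ q M).mpr (hq₁.of_dvd (dvd_mul_left M 3))
  rw [hχdef, chi3Mul_natCast ψ hq₁cop, chi3_congr hq₁3] at e
  have hq₁N : Nat.Coprime q₁ N := (coprime_three_mul_iff.mp hq₁cop).2
  have eψ : ψ ((q₁ : ℕ) : ZMod N) = θ ((q : ℕ) : ZMod M) := by
    rw [hψθ, ← ZMod.coe_unitOfCoprime q₁ hq₁N, DirichletCharacter.changeLevel_eq_cast_of_dvd θ hMN,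
      ZMod.coe_unitOfCoprime, ZMod.cast_natCast hMN, hq₁M]
  rw [eψ] at e
  have hq3' : ¬ 3 ∣ q := fun h => hq3 ((Nat.prime_dvd_prime_iff_eq Nat.prime_three hqq).mp h).symm
  have hθq : θ ((q : ℕ) : ZMod M) = (chi3 q : ℂ) := by
    have hsq' := chi3_mul_self hq3'
    have : (chi3 q : ℂ) * ((chi3 q : ℂ) * θ ((q : ℕ) : ZMod M)) = (chi3 q : ℂ) := by rw [e, mul_one]
    rw [← mul_assoc] at this
    have hcc : (chi3 q : ℂ) * (chi3 q : ℂ) = 1 := by exact_mod_cast hsq'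
    rw [hcc, one_mul] at this
    exact this
  refine ⟨q, hq, ?_⟩
  rw [cosetC, dif_pos hqN, Finset.mem_filter]
  exact ⟨Finset.mem_univ _, θ, hψθ, hθq⟩

end bad

/-! ## 6. The exceptional sets of `E⁻` and `D⁺`, and the supports -/

section excsets

variable {N : ℕ} [NeZero N]

open Classical in
/-- the characters where `Ê⁻` may fail to vanish: `χ` odd with `χ⁻¹` BAD -/
noncomputable def badMu (N : ℕ) [NeZero N] : Finset (DirichletCharacter ℂ N) :=
  Finset.univ.filter (fun χ => χ.Odd ∧ ¬ Good χ⁻¹)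

open Classical in
/-- the characters where `D̂⁺` may fail to vanish: `χ = 1`, or `χ` even with `χ₃ × χ⁻¹` BAD -/
noncomputable def badNu (N : ℕ) [NeZero N] : Finset (DirichletCharacter ℂ N) :=
  Finset.univ.filter (fun χ => χ = 1 ∨ (χ.Even ∧ ¬ Good (chi3Mul χ⁻¹)))

open Classical in
/-- `2 · #badMu N ≤ Σ_{q ∣ N} tauV N q` (squarefree `N`) -/
theorem two_mul_card_badMu_le (hsq : Squarefree N) :
    2 * (badMu N).card ≤ ∑ q ∈ N.primeFactors, tauV N q := by
  have h1 : (badMu N).card ≤ (N.primeFactors.biUnion (fun q => oddK N q)).card := by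
    refine Finset.card_le_card_of_injOn (fun χ => χ⁻¹) ?_ ?_
    · intro χ hχ
      rw [Finset.mem_coe, badMu, Finset.mem_filter] at hχ
      obtain ⟨q, hq, hmem⟩ := mem_oddK_of_bad (odd_inv' hχ.2.1) hχ.2.2
      rw [Finset.mem_coe, Finset.mem_biUnion]
      exact ⟨q, hq, hmem⟩
    · intro a _ b _ h
      exact inv_injective h
  have h2 : (N.primeFactors.biUnion (fun q => oddK N q)).card ≤ ∑ q ∈ N.primeFactors, (oddK N q).card :=
    Finset.card_biUnion_le
  have h3 : 2 * ∑ q ∈ N.primeFactors, (oddK N q).card ≤ ∑ q ∈ N.primeFactors, tauV N q := by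
    rw [Finset.mul_sum]
    exact Finset.sum_le_sum (fun q hq => two_mul_card_oddK_le hsq hq)
  omega

open Classical in
/-- `#badNu N ≤ 1 + Σ_{q ∣ N} tauV N q` (squarefree `N`, `3 ∤ N`) -/
theorem card_badNu_le (hsq : Squarefree N) (h3N : ¬ 3 ∣ N) :
    (badNu N).card ≤ 1 + ∑ q ∈ N.primeFactors, tauV N q := by
  set B' := Finset.univ.filter (fun χ : DirichletCharacter ℂ N => ¬ Good (chi3Mul χ⁻¹)) with hB'
  have hsub : badNu N ⊆ {1} ∪ B' := by
    intro χ hχ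
    rw [badNu, Finset.mem_filter] at hχ
    rcases hχ.2 with h | h
    · exact Finset.mem_union_left _ (Finset.mem_singleton.mpr h)
    · exact Finset.mem_union_right _ (by rw [hB', Finset.mem_filter]; exact ⟨Finset.mem_univ _, h.2⟩)
  have h1 : (badNu N).card ≤ 1 + B'.card := by
    calc (badNu N).card ≤ ({1} ∪ B').card := Finset.card_le_card hsub
      _ ≤ ({1} : Finset (DirichletCharacter ℂ N)).card + B'.card := Finset.card_union_le _ _
      _ = 1 + B'.card := by rw [Finset.card_singleton]
  have h2 : B'.card ≤ (N.primeFactors.biUnion (fun q => cosetC N q)).card := by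
    refine Finset.card_le_card_of_injOn (fun χ => χ⁻¹) ?_ ?_
    · intro χ hχ
      rw [Finset.mem_coe, hB', Finset.mem_filter] at hχ
      obtain ⟨q, hq, hmem⟩ := mem_cosetC_of_bad hsq h3N χ⁻¹ hχ.2
      rw [Finset.mem_coe, Finset.mem_biUnion]
      exact ⟨q, hq, hmem⟩
    · intro a _ b _ h
      exact inv_injective h
  have h3 : (N.primeFactors.biUnion (fun q => cosetC N q)).card ≤ ∑ q ∈ N.primeFactors, tauV N q :=
    Finset.card_biUnion_le.trans (Finset.sum_le_sum (fun q hq => card_cosetC_le hsq hq))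
  omega

end excsets

end HodgeFermat.KRFree.BadVanish
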